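import Summits.Schanuel.Schanuel.Theorems.RootDecomp1KCommonRadixCell05

/-!
# RootDecomp1KCommonRadixCell — lens 1, generation 37 «COMMON-RADIX WALL CELL of 33364» (the dependent-base wall `(1, ℓ₂, ℓ₄)`) — continuation (RootDecomp1KCommonRadixCell06): §8 the cells against the LIVE item's binders (`finiteOrderLiouvilleSchanuel_wallCell24 (hNW)`, `_pi`, `_liouvilleBlockCell`, `_commonRadixCell`, `_cell248_pi`) and the members `z_V = (1, ℓ₂, ℓ₄)`, `z_V^π`

(lens-1 g37 `RootDecomp1KCommonRadixCell.lean`, sha256 2ee3a3e8…2418, own farm rc 0 · 0 sorry · axioms std; critic VERDICT STATUS L1748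
(credit K-R23 (β′), PORT GO LOW); port by census-1 gen 16 in seven parts `RootDecomp1KCommonRadixCell01`–`07` — see the PORT NOTE of part 01;
`--supports stmt-Schanuel-33364`; rung 0.)
-/

noncomputable section

open Complex IntermediateField Polynomial
open Summit.Schanuel.Schanuel.Theorems.RootDecomp1KHyper
open Summit.Schanuel.Schanuel.Theorems.RootDecomp1KHyper.HyperCell
open Summit.Schanuel.Schanuel.Theorems.RootDecomp1KGeneric
open Summit.Schanuel.Schanuel.Theorems.RootDecomp1KRelLiouvilleCell
open Summit.Schanuel.Schanuel.Theorems.RootDecomp1KLogLogCell (LogLogLiouville logLogLiouville_of_logSqLiouville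
  logLogLiouville_of_logHyperLiouville logLogLiouville_of_hyperLiouville)
open Summit.Schanuel.Schanuel.Theorems.RootDecomp1KTwoBaseCell (partialSum_pos' liouvilleNumber_le partialSum_lt_two numerator_lt exists_int_mul_eq_map' algebraicIndependent_of_forall_int' norm_pow_sub_pow_le' norm_prod_pow_sub_prod_pow_le norm_aeval_sub_aeval_le growth_beats lpart
  tpart lpart_apply tpart_apply eq_of_parts_eq psNumer partialSum_eq_psNumer_div coprime_psNumer liouvilleNumber_sub_rat_lower_loglog not_logLogLiouville_liouvilleNumber liouvilleNumber_three_lt_one sb_of_range_eq')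

namespace Summit.Schanuel.Schanuel.Theorems.RootDecomp1KCommonRadixCell

open LiouvilleNumber
open scoped Nat

section Cells
open LiouvilleNumber
open scoped Nat

/-- **ITEM 33364 ON THE DEPENDENT-BASE WALL CELL `(1, ℓ₂, ℓ₄)` (e-version, mod `hNW`).** Binders of
`Summit.Schanuel.Schanuel.Theses.RootDecomp1K.FiniteOrderLiouvilleSchanuel` VERBATIM, with ONE line inserted after
`LinearIndependent ℚ z` — the cell `Set.range z = Set.range (1, ℓ₂, ℓ₄)`. The two Diophantine hypotheses are not used
by the proof (the conclusion holds outright on the cell); they are CERTIFIED at the member `z_V` below. -/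
theorem finiteOrderLiouvilleSchanuel_wallCell24 (hNW : NWMeasure) :
    ∀ (n : ℕ) (z : Fin n → ℂ), LinearIndependent ℚ z →
      Set.range z = Set.range ![(1 : ℂ), ((liouvilleNumber 2 : ℝ) : ℂ), ((liouvilleNumber 4 : ℝ) : ℂ)] →
      (∀ ω : ℕ, ∃ h : Fin n → ℤ, h ≠ 0 ∧ ‖∑ i, (h i : ℂ) * z i‖ < 1 / (1 + ∑ i, (|h i| : ℝ)) ^ ω) →
      (¬ ∀ m : ℕ, ∃ h : Fin n → ℤ, h ≠ 0 ∧
        ‖∑ i, (h i : ℂ) * z i‖ < Real.exp (-((1 + ∑ i, (|h i| : ℝ)) ^ m))) →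
      (n : Cardinal) ≤ Algebra.trdeg ℚ
        ↥(IntermediateField.adjoin ℚ (Set.range z ∪ Set.range (Complex.exp ∘ z))) := by
  intro n z hz hrange _ _
  exact sb_of_range_eq' hz.injective hrange (sb_wallCell24 hNW)

/-- **ITEM 33364 ON THE DEPENDENT-BASE WALL CELL, π-version — HYPOTHESIS-FREE.** Same binders verbatim, the cell line
`Set.range z = Set.range (π, πℓ₂, πℓ₄)`. -/
theorem finiteOrderLiouvilleSchanuel_wallCell24_pi :
    ∀ (n : ℕ) (z : Fin n → ℂ), LinearIndependent ℚ z →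
      Set.range z = Set.range ![(Real.pi : ℂ), (Real.pi : ℂ) * ((liouvilleNumber 2 : ℝ) : ℂ),
        (Real.pi : ℂ) * ((liouvilleNumber 4 : ℝ) : ℂ)] →
      (∀ ω : ℕ, ∃ h : Fin n → ℤ, h ≠ 0 ∧ ‖∑ i, (h i : ℂ) * z i‖ < 1 / (1 + ∑ i, (|h i| : ℝ)) ^ ω) →
      (¬ ∀ m : ℕ, ∃ h : Fin n → ℤ, h ≠ 0 ∧
        ‖∑ i, (h i : ℂ) * z i‖ < Real.exp (-((1 + ∑ i, (|h i| : ℝ)) ^ m))) →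
      (n : Cardinal) ≤ Algebra.trdeg ℚ
        ↥(IntermediateField.adjoin ℚ (Set.range z ∪ Set.range (Complex.exp ∘ z))) := by
  intro n z hz hrange _ _
  exact sb_of_range_eq' hz.injective hrange sb_wallCell24_pi

/-- **ITEM 33364 ON EVERY LIOUVILLE-BLOCK CELL `(1, ℓ_{b_1}, …, ℓ_{b_k})` (e-version, mod `hNW`)** — ANY bases
`b_i ≥ 2` with an algebraically independent block (common radix: next theorem; injective weights: g36).
Binders verbatim + one cell line. -/
theorem finiteOrderLiouvilleSchanuel_liouvilleBlockCell (hNW : NWMeasure) {k : ℕ} {b : Fin k → ℕ}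
    (hb : ∀ i, 2 ≤ b i) (hAI : AlgebraicIndependent ℚ (fun i => ((liouvilleNumber (b i) : ℝ) : ℂ))) :
    ∀ (n : ℕ) (z : Fin n → ℂ), LinearIndependent ℚ z →
      Set.range z = Set.range (Fin.cons (1 : ℂ) (fun i => ((liouvilleNumber (b i) : ℝ) : ℂ))) →
      (∀ ω : ℕ, ∃ h : Fin n → ℤ, h ≠ 0 ∧ ‖∑ i, (h i : ℂ) * z i‖ < 1 / (1 + ∑ i, (|h i| : ℝ)) ^ ω) →
      (¬ ∀ m : ℕ, ∃ h : Fin n → ℤ, h ≠ 0 ∧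
        ‖∑ i, (h i : ℂ) * z i‖ < Real.exp (-((1 + ∑ i, (|h i| : ℝ)) ^ m))) →
      (n : Cardinal) ≤ Algebra.trdeg ℚ
        ↥(IntermediateField.adjoin ℚ (Set.range z ∪ Set.range (Complex.exp ∘ z))) := by
  intro n z hz hrange _ _
  exact sb_of_range_eq' hz.injective hrange (sb_liouvilleBlockCell hNW hb hAI)

/-- **ITEM 33364 ON EVERY LIOUVILLE-BLOCK CELL, π-version — HYPOTHESIS-FREE given the independence of the block.** -/
theorem finiteOrderLiouvilleSchanuel_liouvilleBlockCell_pi {k : ℕ} {b : Fin k → ℕ}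
    (hb : ∀ i, 2 ≤ b i) (hAI : AlgebraicIndependent ℚ (fun i => ((liouvilleNumber (b i) : ℝ) : ℂ))) :
    ∀ (n : ℕ) (z : Fin n → ℂ), LinearIndependent ℚ z →
      Set.range z = Set.range (Fin.cons (Real.pi : ℂ)
        (fun i => (Real.pi : ℂ) * ((liouvilleNumber (b i) : ℝ) : ℂ))) →
      (∀ ω : ℕ, ∃ h : Fin n → ℤ, h ≠ 0 ∧ ‖∑ i, (h i : ℂ) * z i‖ < 1 / (1 + ∑ i, (|h i| : ℝ)) ^ ω) →
      (¬ ∀ m : ℕ, ∃ h : Fin n → ℤ, h ≠ 0 ∧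
        ‖∑ i, (h i : ℂ) * z i‖ < Real.exp (-((1 + ∑ i, (|h i| : ℝ)) ^ m))) →
      (n : Cardinal) ≤ Algebra.trdeg ℚ
        ↥(IntermediateField.adjoin ℚ (Set.range z ∪ Set.range (Complex.exp ∘ z))) := by
  intro n z hz hrange _ _
  exact sb_of_range_eq' hz.injective hrange (sb_liouvilleBlockCell_pi hb hAI)

/-- **ITEM 33364 ON EVERY COMMON-RADIX CELL `(1, ℓ_{β^{a_1}}, …, ℓ_{β^{a_k}})` (e-version, mod `hNW`)** — `β ≥ 2`,
`a` injective, `a_i ≥ 1`; no further hypothesis. -/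
theorem finiteOrderLiouvilleSchanuel_commonRadixCell (hNW : NWMeasure) {k β : ℕ} (hβ : 2 ≤ β)
    {a : Fin k → ℕ} (ha : Function.Injective a) (ha1 : ∀ i, 1 ≤ a i) :
    ∀ (n : ℕ) (z : Fin n → ℂ), LinearIndependent ℚ z →
      Set.range z = Set.range (Fin.cons (1 : ℂ)
        (fun i => ((liouvilleNumber ((β ^ a i : ℕ) : ℝ) : ℝ) : ℂ))) →
      (∀ ω : ℕ, ∃ h : Fin n → ℤ, h ≠ 0 ∧ ‖∑ i, (h i : ℂ) * z i‖ < 1 / (1 + ∑ i, (|h i| : ℝ)) ^ ω) →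
      (¬ ∀ m : ℕ, ∃ h : Fin n → ℤ, h ≠ 0 ∧
        ‖∑ i, (h i : ℂ) * z i‖ < Real.exp (-((1 + ∑ i, (|h i| : ℝ)) ^ m))) →
      (n : Cardinal) ≤ Algebra.trdeg ℚ
        ↥(IntermediateField.adjoin ℚ (Set.range z ∪ Set.range (Complex.exp ∘ z))) := by
  intro n z hz hrange _ _
  exact sb_of_range_eq' hz.injective hrange (sb_commonRadixCell hNW hβ ha ha1)

/-- **ITEM 33364 ON EVERY COMMON-RADIX CELL, π-version — HYPOTHESIS-FREE.** -/
theorem finiteOrderLiouvilleSchanuel_commonRadixCell_pi {k β : ℕ} (hβ : 2 ≤ β)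
    {a : Fin k → ℕ} (ha : Function.Injective a) (ha1 : ∀ i, 1 ≤ a i) :
    ∀ (n : ℕ) (z : Fin n → ℂ), LinearIndependent ℚ z →
      Set.range z = Set.range (Fin.cons (Real.pi : ℂ)
        (fun i => (Real.pi : ℂ) * ((liouvilleNumber ((β ^ a i : ℕ) : ℝ) : ℝ) : ℂ))) →
      (∀ ω : ℕ, ∃ h : Fin n → ℤ, h ≠ 0 ∧ ‖∑ i, (h i : ℂ) * z i‖ < 1 / (1 + ∑ i, (|h i| : ℝ)) ^ ω) →
      (¬ ∀ m : ℕ, ∃ h : Fin n → ℤ, h ≠ 0 ∧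
        ‖∑ i, (h i : ℂ) * z i‖ < Real.exp (-((1 + ∑ i, (|h i| : ℝ)) ^ m))) →
      (n : Cardinal) ≤ Algebra.trdeg ℚ
        ↥(IntermediateField.adjoin ℚ (Set.range z ∪ Set.range (Complex.exp ∘ z))) := by
  intro n z hz hrange _ _
  exact sb_of_range_eq' hz.injective hrange (sb_commonRadixCell_pi hβ ha ha1)

/-- **ITEM 33364 ON THE CELL `(π, πℓ₂, πℓ₄, πℓ₈)` — HYPOTHESIS-FREE** (a `k = 3` common-radix instance). -/
theorem finiteOrderLiouvilleSchanuel_cell248_pi :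
    ∀ (n : ℕ) (z : Fin n → ℂ), LinearIndependent ℚ z →
      Set.range z = Set.range ![(Real.pi : ℂ), (Real.pi : ℂ) * ((liouvilleNumber 2 : ℝ) : ℂ),
        (Real.pi : ℂ) * ((liouvilleNumber 4 : ℝ) : ℂ), (Real.pi : ℂ) * ((liouvilleNumber 8 : ℝ) : ℂ)] →
      (∀ ω : ℕ, ∃ h : Fin n → ℤ, h ≠ 0 ∧ ‖∑ i, (h i : ℂ) * z i‖ < 1 / (1 + ∑ i, (|h i| : ℝ)) ^ ω) →
      (¬ ∀ m : ℕ, ∃ h : Fin n → ℤ, h ≠ 0 ∧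
        ‖∑ i, (h i : ℂ) * z i‖ < Real.exp (-((1 + ∑ i, (|h i| : ℝ)) ^ m))) →
      (n : Cardinal) ≤ Algebra.trdeg ℚ
        ↥(IntermediateField.adjoin ℚ (Set.range z ∪ Set.range (Complex.exp ∘ z))) := by
  intro n z hz hrange _ _
  exact sb_of_range_eq' hz.injective hrange sb_cell248_pi

/-! ### The members `z_V = (1, ℓ₂, ℓ₄)` and `z_V^π = (π, πℓ₂, πℓ₄)` -/

/-- The dependent-base wall member `z_V := (1, ℓ₂, ℓ₄)`. -/
def zV : Fin 3 → ℂ := ![(1 : ℂ), ((liouvilleNumber 2 : ℝ) : ℂ), ((liouvilleNumber 4 : ℝ) : ℂ)]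

/-- Its π-twin `z_V^π := (π, πℓ₂, πℓ₄)`. -/
def zVpi : Fin 3 → ℂ :=
  ![(Real.pi : ℂ), (Real.pi : ℂ) * ((liouvilleNumber 2 : ℝ) : ℂ), (Real.pi : ℂ) * ((liouvilleNumber 4 : ℝ) : ℂ)]

/-- `z_V = (1, ℓ₂, ℓ₄)` (unfolding). -/
theorem zV_eq : zV = ![(1 : ℂ), ((liouvilleNumber 2 : ℝ) : ℂ), ((liouvilleNumber 4 : ℝ) : ℂ)] := rfl

/-- `z_V^π = (π, πℓ₂, πℓ₄)` (unfolding). -/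
theorem zVpi_eq : zVpi = ![(Real.pi : ℂ), (Real.pi : ℂ) * ((liouvilleNumber 2 : ℝ) : ℂ),
    (Real.pi : ℂ) * ((liouvilleNumber 4 : ℝ) : ℂ)] := rfl

/-- An integer form in `z_V` is the real number `g₀ + g₁ ℓ₂ + g₂ ℓ₄`. -/
theorem zV_form (g : Fin 3 → ℤ) :
    ∑ i, (g i : ℂ) * zV i = (((g 0 : ℝ) + g 1 * liouvilleNumber 2 + g 2 * liouvilleNumber 4 : ℝ) : ℂ) := by
  rw [Fin.sum_univ_three]
  simp only [zV, Matrix.cons_val_zero, Matrix.cons_val_one, Matrix.cons_val_two, Matrix.head_cons,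
    Matrix.tail_cons]
  push_cast; ring

/-- An integer form in `z_V^π` is `π · (g₀ + g₁ ℓ₂ + g₂ ℓ₄)`. -/
theorem zVpi_form (g : Fin 3 → ℤ) :
    ∑ i, (g i : ℂ) * zVpi i =
      (Real.pi : ℂ) * (((g 0 : ℝ) + g 1 * liouvilleNumber 2 + g 2 * liouvilleNumber 4 : ℝ) : ℂ) := by
  rw [Fin.sum_univ_three]
  simp only [zVpi, Matrix.cons_val_zero, Matrix.cons_val_one, Matrix.cons_val_two, Matrix.head_cons,
    Matrix.tail_cons]
  push_cast; ring

/-- The norm of an integer form in `z_V` is `|g₀ + g₁ℓ₂ + g₂ℓ₄|`. -/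
theorem norm_zV_form (g : Fin 3 → ℤ) :
    ‖∑ i, (g i : ℂ) * zV i‖ = |(g 0 : ℝ) + g 1 * liouvilleNumber 2 + g 2 * liouvilleNumber 4| := by
  rw [zV_form, Complex.norm_real, Real.norm_eq_abs]

/-- The norm of an integer form in `z_V^π` is `π·|g₀ + g₁ℓ₂ + g₂ℓ₄|`. -/
theorem norm_zVpi_form (g : Fin 3 → ℤ) :
    ‖∑ i, (g i : ℂ) * zVpi i‖ =
      Real.pi * |(g 0 : ℝ) + g 1 * liouvilleNumber 2 + g 2 * liouvilleNumber 4| := by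
  rw [zVpi_form, norm_mul, Complex.norm_real, Complex.norm_real, Real.norm_eq_abs, Real.norm_eq_abs,
    abs_of_pos Real.pi_pos]

/-- No non-zero integer relation among `1, ℓ₂, ℓ₄`. -/
theorem zV_form_ne_zero (g : Fin 3 → ℤ) (hg : g ≠ 0) :
    (g 0 : ℝ) + g 1 * liouvilleNumber 2 + g 2 * liouvilleNumber 4 ≠ 0 := by
  intro h0
  have := form_lower_bound_V g hg
  rw [h0, abs_zero] at this
  exact absurd this (not_le.mpr (Real.exp_pos _))

/-- From integer to rational relations (g36, verbatim; re-proof of the private Cell08 helper). -/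
private theorem linearIndependent_of_int_forms' {z : Fin 3 → ℂ}
    (hz : ∀ g : Fin 3 → ℤ, g ≠ 0 → ∑ i, (g i : ℂ) * z i ≠ 0) : LinearIndependent ℚ z := by
  rw [Fintype.linearIndependent_iff]
  intro g hg
  by_contra hne
  obtain ⟨i₀, hi₀⟩ := not_forall.mp hne
  have hg' : ((g 0 : ℚ) : ℂ) * z 0 + ((g 1 : ℚ) : ℂ) * z 1 + ((g 2 : ℚ) : ℂ) * z 2 = 0 := by
    simpa [Rat.smul_def, Fin.sum_univ_three] using hg
  have e0 : ((g 0 : ℚ) : ℂ) * ((g 0).den : ℂ) = ((g 0).num : ℂ) := by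
    exact_mod_cast Rat.mul_den_eq_num (g 0)
  have e1 : ((g 1 : ℚ) : ℂ) * ((g 1).den : ℂ) = ((g 1).num : ℂ) := by
    exact_mod_cast Rat.mul_den_eq_num (g 1)
  have e2 : ((g 2 : ℚ) : ℂ) * ((g 2).den : ℂ) = ((g 2).num : ℂ) := by
    exact_mod_cast Rat.mul_den_eq_num (g 2)
  set H : Fin 3 → ℤ := ![(g 0).num * ((g 1).den * (g 2).den : ℕ),
    (g 1).num * ((g 0).den * (g 2).den : ℕ), (g 2).num * ((g 0).den * (g 1).den : ℕ)] with hH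
  have hd0 := (g 0).den_pos
  have hd1 := (g 1).den_pos
  have hd2 := (g 2).den_pos
  have hH0 : H ≠ 0 := by
    intro hzero
    have hnum : (g i₀).num ≠ 0 := Rat.num_ne_zero.mpr hi₀
    have hc := congr_fun hzero i₀
    fin_cases i₀
    all_goals
      simp only [hH, Pi.zero_apply] at hc
      exact mul_ne_zero hnum (by positivity) hc
  have hrel : ∑ i, (H i : ℂ) * z i = 0 := by
    rw [Fin.sum_univ_three]
    simp only [hH, Matrix.cons_val_zero, Matrix.cons_val_one, Matrix.cons_val_two, Matrix.head_cons,
      Matrix.tail_cons]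
    push_cast
    linear_combination (-(((g 1).den : ℂ) * ((g 2).den : ℂ) * z 0)) * e0
      - (((g 0).den : ℂ) * ((g 2).den : ℂ) * z 1) * e1
      - (((g 0).den : ℂ) * ((g 1).den : ℂ) * z 2) * e2
      + (((g 0).den : ℂ) * ((g 1).den : ℂ) * ((g 2).den : ℂ)) * hg'
  exact hz H hH0 hrel

/-- **(i) `z_V` is ℚ-linearly independent** (hypothesis-free). -/
theorem linearIndependent_zV : LinearIndependent ℚ zV := by
  refine linearIndependent_of_int_forms' fun g hg hrel => ?_
  have h := zV_form g
  rw [hrel] at h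
  exact zV_form_ne_zero g hg (by exact_mod_cast h.symm)

/-- **(i^π) `z_V^π` is ℚ-linearly independent** (hypothesis-free). -/
theorem linearIndependent_zVpi : LinearIndependent ℚ zVpi := by
  refine linearIndependent_of_int_forms' fun g hg hrel => ?_
  have h := zVpi_form g
  rw [hrel] at h
  have hπ0 : (Real.pi : ℂ) ≠ 0 := by exact_mod_cast Real.pi_ne_zero
  have h' := (mul_eq_zero.mp h.symm).resolve_left hπ0
  exact zV_form_ne_zero g hg (by exact_mod_cast h')

/-- **(ii) `z_V` is Liouville to every polynomial order** (through its prefix `(1, ℓ₂)`; hypothesis-free). -/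
theorem linLiouville_zV : LinLiouville zV := by
  have hℓ : Liouville (liouvilleNumber 2) := by
    simpa using liouville_liouvilleNumber (le_refl 2)
  refine linLiouville_of_prefix (k := 2) (n := 3) (by norm_num) ?_
  have h2 : (fun i : Fin 2 => zV (Fin.castLE (show 2 ≤ 3 by norm_num) i)) =
      ![(1 : ℂ), ((liouvilleNumber 2 : ℝ) : ℂ) * 1] := by
    funext i; fin_cases i <;> simp [zV]
  rw [h2]
  exact linLiouville_of_liouville_ratio hℓ 1

/-- **(ii^π) `z_V^π` is Liouville to every polynomial order** (prefix `(π, πℓ₂)`; hypothesis-free). -/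
theorem linLiouville_zVpi : LinLiouville zVpi := by
  have hℓ : Liouville (liouvilleNumber 2) := by
    simpa using liouville_liouvilleNumber (le_refl 2)
  refine linLiouville_of_prefix (k := 2) (n := 3) (by norm_num) ?_
  have h2 : (fun i : Fin 2 => zVpi (Fin.castLE (show 2 ≤ 3 by norm_num) i)) =
      ![(Real.pi : ℂ), ((liouvilleNumber 2 : ℝ) : ℂ) * (Real.pi : ℂ)] := by
    funext i; fin_cases i <;> simp [zVpi, mul_comm]
  rw [h2]
  exact linLiouville_of_liouville_ratio hℓ (Real.pi : ℂ)

/-- **(iii) `z_V` has NO hyper-small integer forms** (the two-scale bound §7; hypothesis-free). -/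
theorem not_hyperLinLiouville_zV : ¬ HyperLinLiouville zV := by
  intro hH
  obtain ⟨g, hg, hlt⟩ := hH 12
  rw [norm_zV_form] at hlt
  have hlow := form_lower_bound_V g hg
  have hX : (1 : ℝ) ≤ 1 + ∑ i, (|g i| : ℝ) := by
    have : (0 : ℝ) ≤ ∑ i, (|g i| : ℝ) :=
      Finset.sum_nonneg fun i _ => by exact_mod_cast abs_nonneg (g i)
    linarith
  have hmono : (1 + ∑ i, (|g i| : ℝ)) ^ 11 ≤ (1 + ∑ i, (|g i| : ℝ)) ^ 12 :=
    pow_le_pow_right₀ hX (by norm_num)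
  have := Real.exp_le_exp.mpr (neg_le_neg hmono)
  linarith

/-- **(iii^π) `z_V^π` has NO hyper-small integer forms** (`|π·form| ≥ |form|`; hypothesis-free). -/
theorem not_hyperLinLiouville_zVpi : ¬ HyperLinLiouville zVpi := by
  intro hH
  obtain ⟨g, hg, hlt⟩ := hH 12
  rw [norm_zVpi_form] at hlt
  have hlow := form_lower_bound_V g hg
  have hX : (1 : ℝ) ≤ 1 + ∑ i, (|g i| : ℝ) := by
    have : (0 : ℝ) ≤ ∑ i, (|g i| : ℝ) :=
      Finset.sum_nonneg fun i _ => by exact_mod_cast abs_nonneg (g i)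
    linarith
  have hmono : (1 + ∑ i, (|g i| : ℝ)) ^ 11 ≤ (1 + ∑ i, (|g i| : ℝ)) ^ 12 :=
    pow_le_pow_right₀ hX (by norm_num)
  have := Real.exp_le_exp.mpr (neg_le_neg hmono)
  have hπ : (1 : ℝ) ≤ Real.pi := by have := Real.pi_gt_three; linarith
  have habs := abs_nonneg ((g 0 : ℝ) + g 1 * liouvilleNumber 2 + g 2 * liouvilleNumber 4)
  nlinarith

/-- **(iv) Schanuel's bound AT `z_V`** (mod `hNW` only). -/
theorem sb_zV (hNW : NWMeasure) : SB 3 zV := sb_wallCell24 hNW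

/-- **(iv^π) Schanuel's bound AT `z_V^π` — HYPOTHESIS-FREE.** -/
theorem sb_zVpi : SB 3 zVpi := sb_wallCell24_pi

/-- **`z_V` lies in the scope of item 33364** — all three hypotheses, hypothesis-free. -/
theorem zV_in_scope_33364 :
    LinearIndependent ℚ zV ∧
    (∀ ω : ℕ, ∃ h : Fin 3 → ℤ, h ≠ 0 ∧ ‖∑ i, (h i : ℂ) * zV i‖ < 1 / (1 + ∑ i, (|h i| : ℝ)) ^ ω) ∧
    (¬ ∀ m : ℕ, ∃ h : Fin 3 → ℤ, h ≠ 0 ∧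
      ‖∑ i, (h i : ℂ) * zV i‖ < Real.exp (-((1 + ∑ i, (|h i| : ℝ)) ^ m))) :=
  ⟨linearIndependent_zV, linLiouville_zV, not_hyperLinLiouville_zV⟩

/-- **`z_V^π` lies in the scope of item 33364** — all three hypotheses, hypothesis-free. -/
theorem zVpi_in_scope_33364 :
    LinearIndependent ℚ zVpi ∧
    (∀ ω : ℕ, ∃ h : Fin 3 → ℤ, h ≠ 0 ∧ ‖∑ i, (h i : ℂ) * zVpi i‖ < 1 / (1 + ∑ i, (|h i| : ℝ)) ^ ω) ∧
    (¬ ∀ m : ℕ, ∃ h : Fin 3 → ℤ, h ≠ 0 ∧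
      ‖∑ i, (h i : ℂ) * zVpi i‖ < Real.exp (-((1 + ∑ i, (|h i| : ℝ)) ^ m))) :=
  ⟨linearIndependent_zVpi, linLiouville_zVpi, not_hyperLinLiouville_zVpi⟩

/-- **ITEM 33364 DECIDED AT `z_V`** (mod `hNW`): scope (i)–(iii) hypothesis-free AND the conclusion. -/
theorem finiteOrderLiouvilleSchanuel_at_zV (hNW : NWMeasure) :
    LinearIndependent ℚ zV ∧ LinLiouville zV ∧ ¬ HyperLinLiouville zV ∧ SB 3 zV :=
  ⟨linearIndependent_zV, linLiouville_zV, not_hyperLinLiouville_zV, sb_zV hNW⟩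

/-- **ITEM 33364 DECIDED AT `z_V^π` — HYPOTHESIS-FREE**: scope (i)–(iii) AND the conclusion. -/
theorem finiteOrderLiouvilleSchanuel_at_zVpi :
    LinearIndependent ℚ zVpi ∧ LinLiouville zVpi ∧ ¬ HyperLinLiouville zVpi ∧ SB 3 zVpi :=
  ⟨linearIndependent_zVpi, linLiouville_zVpi, not_hyperLinLiouville_zVpi, sb_zVpi⟩

end Cells

end Summit.Schanuel.Schanuel.Theorems.RootDecomp1KCommonRadixCell

end
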